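/-
Copyright (c) 2026 the pub-hodgecm-mathlib formalisation cell (harness21).  Prover seat hodgecm-mathlib-R90-C131-p05 (g2), R90-TF SLAB section S4
«Ch13.1–2» (base R90-C131), h413 = `stmt-HodgeConjecture-24833`; brick (DICT)(2) F1″ (S4 dealer K2E2-plan (g7), R90 bus 2026-09-05T02:07:06Z; census 02:09:50Z).
-/
import Summits.HodgeConjecture.HodgeConjecture.Theorems.R90S4TypeOneWeylIndex            -- (this seat) ★ p864370: the `(cmDatum L 3 H).Local v = U(σ_v, H_v)` plumbing environment (★ `LocalUnitaryGroupCongr`, ★ `F0P3cStCharTSWeylHypCM`)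
import Summits.HodgeConjecture.HodgeConjecture.Theorems.R90S4TwistedTransferDefs          -- ★ C-TT (K2E3-p27): `IsStablyConjGAt` (stable conjugacy on the `cmDatum` carrier = conjugacy in `GL₃(L ⊗ L⁺_v)`)
import Summits.HodgeConjecture.HodgeConjecture.Theorems.R90S4SplitFormHermitian           -- ★ `splitFormGL`, `splitFormGL_isHermitian` (the `Gqs` instance)
import Literature.NumberTheory.Rogawski1990.LocalStableClassesNonsplitTypeTwoCount        -- ★ (L4a) type (2): `exists_isStablyConj_not_isConj_and_forall` (two classes, block-frame letter)
import HarnessLib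

/-!
# R90-TF · S4 — (DICT)(2) F1″ `R90S4TypeTwoStableClassSplit`: the local stable class of a TYPE-(2) element of `U(Φ)(L⁺_v)` (`v` non-split) splits into EXACTLY TWO classes — the
# S4-currency export of ★ `LocalStableClassesNonsplitTypeTwoCount` (Rogawski 1990, §3.5 Prop. 3.5.2 (c) p. 26, §3.6 pp. 28–29: `|𝔇(T∕F)| = 2` for `T = T_K × E¹`)

Cell `hodgecm-mathlib`, crux H413 = `stmt-HodgeConjecture-24833`, route of record `HCCMUnconditional`; R90-TF section S4 (Rogawski Ch. 13.1–2, base `R90-C131`), seat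
R90-C131-p05 (g2); brick F1″ of the stable transport dictionary (DICT)(2) (type (2) members of the Cartan cover), consumed by the type-(2) rows of p12's ★
`isStableTransportDict_of_forall_member` (clause (B): for every regular `t` of the member, the stable class of `t` is the union of the classes of its `k = 2` transports).
THEOREMS ONLY (no `def`, no `instance`, no notation, no named-fact hypothesis, no `sorry`; default heartbeats); ★-only imports; lane `--supports stmt-HodgeConjecture-24833 --as helper`.

THE MATHEMATICS.  `v` a finite place of `L⁺` NON-SPLIT in `L`, `σ = conjLocal`, `Φ ∈ GL₃(L)` hermitian (`ᵗ(σΦ) = Φ`), `G_v = U(Φ)(L⁺_v) = (cmDatum L 3 Φ).Local v = U(σ, Φ_v)`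
(★ `local_eq_unitaryGroupOfForm_map`; the SAME invertible matrices as ★ `ShimuraVarieties.unitaryGroup σ Φ_v`, so the two carriers are related by `MulEquiv.subgroupCongr` with
unchanged `GL₃` values).  TYPE (2) in the letter of the ★ brick: a BLOCK FRAME `γ · P = P · [A 0; 0 u]` (`e : Fin 2 ⊕ Fin 1 ≃ Fin 3` the block pattern) with `χ_A` IRREDUCIBLE over
`L_w` — `Z(γ) ≅ L₄ × L_w`, `T = Z_G(γ) ≅ T_K × E¹` [§3.6 type (2)].  ★ `exists_isStablyConj_not_isConj_and_forall`: there is `δ₀ ∈ U(σ, Φ_v)` stably conjugate and NOT conjugate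
to `γ`, and every stable conjugate of `γ` is conjugate to `γ` or to `δ₀` ([Prop. 3.5.2 (c)]: `|𝓡(T∕F)| = 2^{r−1}`, `r = 2`).  HERE: the same statement on the S4 carrier with ★
`IsStablyConjGAt L Φ v` (conjugacy in `G̃_v = GL₃(L ⊗ L⁺_v)` of the values — DEFINITIONALLY the brick's `IsStablyConj`) and `IsConj` in `G_v` (transported along the `subgroupCongr`
isomorphism by `map_isConj`): **`exists_isStablyConjGAt_not_isConj_and_forall_of_blockFrame`**; the iff form **`isStablyConjGAt_iff_isConj_or_of_blockFrame`** («`γ′ ∼_{st} γ ⟺ γ′ ∼ γ ∨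
γ′ ∼ γ₂`»); and the `Gqs L v = U(Φ₃)(L⁺_v)` instances at `Φ := splitFormGL L` (★ `splitFormGL_isHermitian`).  The INPUT letter is the brick's block frame (α); the bridge from the
characteristic-polynomial letter «`χ_γ = q · (X − u)`, `q` irreducible quadratic» (β) is a separate file if the members arrive that way (census 02:09:50Z).

HONEST LABEL: HC_CM is proved only modulo the 7 printed citations (2 remaining named inputs: hLiu418 = `stmt-HodgeConjecture-24832`, h413 = `stmt-HodgeConjecture-24833`) until
rung 0 closes; F1″ is an input of the type-(2) rows of `hdict` behind ★ (B2-S) behind the OPEN (W-NP) socket — a ★ helper closes no socket; REL ≠ ★ ≠ BUILT; count-neutral.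

## References
* [Rogawski1990] J. D. Rogawski, *Automorphic Representations of Unitary Groups in Three Variables*, Ann. of Math. Stud. 123 (1990), §3.1 p. 19 (stable conjugacy), §3.5
  Prop. 3.5.2 (a)(c) pp. 25–26 (`𝓡(T∕F)`, `|𝓡| = 2^{r−1}`), §3.6 pp. 28–29 (type (2): `T_K × E¹`).
* [Kottwitz1986] R. E. Kottwitz, *Stable trace formula: elliptic singular terms*, Math. Ann. 275 (1986), §7.
-/

set_option autoImplicit false
-- the mandated namespace repeats the single-problem summit's segment (`HodgeConjecture.HodgeConjecture`)
set_option linter.dupNamespace false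

open Matrix Polynomial
open NumberField IsDedekindDomain
open Literature.NumberTheory.Automorphic Literature.NumberTheory.Automorphic.UnitaryGroup Literature.NumberTheory.Rogawski1990
open Literature.AlgebraicGeometry.ShimuraVarieties (unitaryGroup mem_unitaryGroup_iff)
open scoped MatrixGroups

namespace Summit.HodgeConjecture.HodgeConjecture.R90.S4

section TypeTwo

variable (L : Type) [Field L] [NumberField L] [IsCMField L] (Φ : GL (Fin 3) L) (v : HeightOneSpectrum (𝓞 ↥(maximalRealSubfield L)))

/-- Conjugate elements of `G_v` are stably conjugate (conjugacy in `G_v ≤ G̃_v` implies conjugacy in `G̃_v`). [cite: Rogawski1990, §3.1 p. 19] -/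
theorem isStablyConjGAt_of_isConj_local {γ γ' : (UnitaryGroup.cmDatum L 3 (Φ : Matrix (Fin 3) (Fin 3) L)).Local v} (h : IsConj γ γ') :
    IsStablyConjGAt L Φ v γ γ' :=
  (Subgroup.subtype _).map_isConj h

/-- **THE STABLE CLASS OF A TYPE-(2) ELEMENT OF `U(Φ)(L⁺_v)` SPLITS INTO EXACTLY TWO CLASSES** (`v` non-split, `Φ` hermitian; block-frame letter `γ P = P [A 0; 0 u]`, `χ_A`
irreducible): there is `γ₂ ∈ G_v` stably conjugate and not conjugate to `γ`, and every stable conjugate of `γ` in `G_v` is conjugate to `γ` or to `γ₂` — ★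
`exists_isStablyConj_not_isConj_and_forall` read on the `cmDatum` carrier. [cite: Rogawski1990, §3.5 Prop. 3.5.2 (c) p. 26; §3.6 p. 28; §3.1 p. 19] [cite: Kottwitz1986, §7] -/
theorem exists_isStablyConjGAt_not_isConj_and_forall_of_blockFrame (hns : ∀ w : PlacesOver L v, IsCMField.complexConj L • w.1 = w.1)
    (hΦ : (((Φ : GL (Fin 3) L) : Matrix (Fin 3) (Fin 3) L).map (IsCMField.complexConj L))ᵀ = Φ)
    (γ : (UnitaryGroup.cmDatum L 3 (Φ : Matrix (Fin 3) (Fin 3) L)).Local v) (P : GL (Fin 3) (LocalRing L v)) (e : Fin 2 ⊕ Fin 1 ≃ Fin 3)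
    (A : Matrix (Fin 2) (Fin 2) (LocalRing L v)) (u : LocalRing L v)
    (hP : (γ.val : GL (Fin 3) (LocalRing L v)).val * P.val = P.val * reindex e e (fromBlocks A 0 0 !![u])) (hA : Irreducible A.charpoly) :
    ∃ γ₂ : (UnitaryGroup.cmDatum L 3 (Φ : Matrix (Fin 3) (Fin 3) L)).Local v,
      IsStablyConjGAt L Φ v γ γ₂ ∧ ¬ IsConj γ γ₂ ∧
        ∀ γ' : (UnitaryGroup.cmDatum L 3 (Φ : Matrix (Fin 3) (Fin 3) L)).Local v, IsStablyConjGAt L Φ v γ γ' → IsConj γ γ' ∨ IsConj γ₂ γ' := by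
  set σv := conjLocal L (IsCMField.complexConj L) v with hσv
  set Hv : Matrix (Fin 3) (Fin 3) (LocalRing L v) := (Φ : Matrix (Fin 3) (Fin 3) L).map (algebraMap L (LocalRing L v)) with hHv
  -- the non-split place data and a CM element `δ₀` with `σ δ₀ = -δ₀ ≠ 0`
  haveI : Algebra.IsQuadraticExtension ↥(maximalRealSubfield L) L := IsCMField.isQuadraticExtension L
  obtain ⟨w⟩ := (inferInstance : Nonempty (PlacesOver L v))
  obtain ⟨x, hx⟩ : ∃ x : L, IsCMField.complexConj L x ≠ x := by
    by_contra h
    exact IsCMField.complexConj_ne_one L (AlgEquiv.ext fun t => not_ne_iff.mp (not_exists.mp h t))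
  have hcδ : IsCMField.complexConj L (x - IsCMField.complexConj L x) = -(x - IsCMField.complexConj L x) := by
    rw [map_sub, IsCMField.complexConj_apply_apply, neg_sub]
  have hδ0 : x - IsCMField.complexConj L x ≠ 0 := sub_ne_zero.2 (Ne.symm hx)
  -- the local unitary group `U(σv, Hv)` in the brick's rendering, and the identification with the `cmDatum` carrier
  have hUH : «local» L (IsCMField.complexConj L) 3 (Φ : Matrix (Fin 3) (Fin 3) L) v = unitaryGroup σv Hv :=
    (local_eq_unitaryGroupOfForm_map _ (Φ : Matrix (Fin 3) (Fin 3) L) v).trans (Subgroup.ext fun _ => Iff.rfl)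
  let E' : (UnitaryGroup.cmDatum L 3 (Φ : Matrix (Fin 3) (Fin 3) L)).Local v ≃* ↥(unitaryGroup σv Hv) := MulEquiv.subgroupCongr hUH
  have hγU : (γ.val : GL (Fin 3) (LocalRing L v)) ∈ unitaryGroup σv Hv := by rw [← hUH]; exact γ.2
  have hEγ : E' γ = ⟨γ.val, hγU⟩ := Subtype.ext rfl
  -- `Hv` is hermitian with unit determinant
  have hHvh : (Hv.map σv)ᵀ = Hv := by
    have hcomp : (σv ∘ algebraMap L (LocalRing L v)) = algebraMap L (LocalRing L v) ∘ IsCMField.complexConj L := by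
      funext t
      exact conjLocal_algebraMap (IsCMField.complexConj L) v t
    rw [hHv, Matrix.map_map, hcomp, ← Matrix.map_map, ← Matrix.transpose_map, hΦ]
  have hHvd : IsUnit Hv.det := by
    rw [hHv, ← RingHom.mapMatrix_apply, ← RingHom.map_det]
    exact (Matrix.GeneralLinearGroup.det Φ).isUnit.map _
  -- the brick
  obtain ⟨δ₀, hst, hnc, hall⟩ :=
    exists_isStablyConj_not_isConj_and_forall L v (IsCMField.complexConj L) hcδ hδ0 e w (hns w) hHvh hHvd hγU hP hA
  refine ⟨E'.symm δ₀, ?_, ?_, fun γ' hγ' => ?_⟩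
  · -- stable conjugacy is conjugacy of the `GL₃` values on both sides
    exact hst
  · intro h
    apply hnc
    have h' := E'.toMonoidHom.map_isConj h
    rwa [MulEquiv.coe_toMonoidHom, hEγ, MulEquiv.apply_symm_apply] at h'
  · have hγ'U : (γ'.val : GL (Fin 3) (LocalRing L v)) ∈ unitaryGroup σv Hv := by rw [← hUH]; exact γ'.2
    have hEγ' : E' γ' = ⟨γ'.val, hγ'U⟩ := Subtype.ext rfl
    have hst' : IsStablyConj σv Hv ⟨(γ.val : GL (Fin 3) (LocalRing L v)), hγU⟩ ⟨γ'.val, hγ'U⟩ := hγ'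
    rcases hall ⟨γ'.val, hγ'U⟩ hst' with h1 | h2
    · left
      have h' := E'.symm.toMonoidHom.map_isConj h1
      rwa [MulEquiv.coe_toMonoidHom, ← hEγ, ← hEγ', MulEquiv.symm_apply_apply, MulEquiv.symm_apply_apply] at h'
    · right
      have h' := E'.symm.toMonoidHom.map_isConj h2
      rwa [MulEquiv.coe_toMonoidHom, ← hEγ', MulEquiv.symm_apply_apply] at h'

/-- **Iff form: `γ′ ∼_{st} γ ⟺ γ′ ∼ γ ∨ γ′ ∼ γ₂`** for a type-(2) `γ ∈ U(Φ)(L⁺_v)` (`v` non-split) and the second class `γ₂` of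
`exists_isStablyConjGAt_not_isConj_and_forall_of_blockFrame`. [cite: Rogawski1990, §3.5 Prop. 3.5.2 (c) p. 26; §3.6 p. 28] -/
theorem isStablyConjGAt_iff_isConj_or_of_blockFrame (hns : ∀ w : PlacesOver L v, IsCMField.complexConj L • w.1 = w.1)
    (hΦ : (((Φ : GL (Fin 3) L) : Matrix (Fin 3) (Fin 3) L).map (IsCMField.complexConj L))ᵀ = Φ)
    (γ : (UnitaryGroup.cmDatum L 3 (Φ : Matrix (Fin 3) (Fin 3) L)).Local v) (P : GL (Fin 3) (LocalRing L v)) (e : Fin 2 ⊕ Fin 1 ≃ Fin 3)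
    (A : Matrix (Fin 2) (Fin 2) (LocalRing L v)) (u : LocalRing L v)
    (hP : (γ.val : GL (Fin 3) (LocalRing L v)).val * P.val = P.val * reindex e e (fromBlocks A 0 0 !![u])) (hA : Irreducible A.charpoly) :
    ∃ γ₂ : (UnitaryGroup.cmDatum L 3 (Φ : Matrix (Fin 3) (Fin 3) L)).Local v,
      IsStablyConjGAt L Φ v γ γ₂ ∧ ¬ IsConj γ γ₂ ∧
        ∀ γ' : (UnitaryGroup.cmDatum L 3 (Φ : Matrix (Fin 3) (Fin 3) L)).Local v, IsStablyConjGAt L Φ v γ γ' ↔ (IsConj γ γ' ∨ IsConj γ₂ γ') := by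
  obtain ⟨γ₂, hst, hnc, hall⟩ := exists_isStablyConjGAt_not_isConj_and_forall_of_blockFrame L Φ v hns hΦ γ P e A u hP hA
  refine ⟨γ₂, hst, hnc, fun γ' => ⟨hall γ', fun h => ?_⟩⟩
  rcases h with h1 | h2
  · exact isStablyConjGAt_of_isConj_local L Φ v h1
  · exact IsConj.trans hst (isStablyConjGAt_of_isConj_local L Φ v h2)

end TypeTwo

/-! ## The `Gqs L v = U(Φ₃)(L⁺_v)` instance (`Φ := splitFormGL L`) -/

section Gqs

variable (L : Type) [Field L] [NumberField L] [IsCMField L] (v : HeightOneSpectrum (𝓞 ↥(maximalRealSubfield L)))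

/-- `Φ₃` is hermitian in the `((·).map σ)ᵀ` spelling (★ `splitFormGL_isHermitian` transposes first). [cite: Rogawski1990, §12.2 p. 171] -/
theorem splitFormGL_map_transpose : (((splitFormGL L : GL (Fin 3) L) : Matrix (Fin 3) (Fin 3) L).map (IsCMField.complexConj L))ᵀ = splitFormGL L := by
  rw [← Matrix.transpose_map]
  exact splitFormGL_isHermitian L

/-- **TYPE (2) IN `Gqs L v = U(Φ₃)(L⁺_v)`: EXACTLY TWO CLASSES IN THE STABLE CLASS** (`v` non-split; block-frame letter): `∃ γ₂`, stably conjugate, not conjugate, and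
`γ′ ∼_{st} γ ⟺ γ′ ∼ γ ∨ γ′ ∼ γ₂` — the (B)-clause input of the type-(2) rows of ★ `isStableTransportDict_of_forall_member` (`k = 2`).
[cite: Rogawski1990, §3.5 Prop. 3.5.2 (c) p. 26; §3.6 p. 28; §12.5 p. 182] -/
theorem exists_isStablyConjGAt_iff_isConj_or_gqs (hns : ∀ w : PlacesOver L v, IsCMField.complexConj L • w.1 = w.1)
    (γ : Gqs L v) (P : GL (Fin 3) (LocalRing L v)) (e : Fin 2 ⊕ Fin 1 ≃ Fin 3) (A : Matrix (Fin 2) (Fin 2) (LocalRing L v)) (u : LocalRing L v)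
    (hP : (γ.val : GL (Fin 3) (LocalRing L v)).val * P.val = P.val * reindex e e (fromBlocks A 0 0 !![u])) (hA : Irreducible A.charpoly) :
    ∃ γ₂ : Gqs L v, IsStablyConjGAt L (splitFormGL L) v γ γ₂ ∧ ¬ IsConj γ γ₂ ∧
      ∀ γ' : Gqs L v, IsStablyConjGAt L (splitFormGL L) v γ γ' ↔ (IsConj γ γ' ∨ IsConj γ₂ γ') :=
  isStablyConjGAt_iff_isConj_or_of_blockFrame L (splitFormGL L) v hns (splitFormGL_map_transpose L) γ P e A u hP hA

end Gqs

end Summit.HodgeConjecture.HodgeConjecture.R90.S4
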